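import Mathlib
import Literature.Analysis.Approximation.InterpolationRemainder
import Literature.NumberTheory.LFunctions.WeilChirpDecay
import Literature.NumberTheory.LFunctions.WeilArchimedeanMoments
import HarnessLib

/-!
# Lagrange sampling of the Weil transform on the critical line (handoff prove-1, ATTEMPT-17 §5; step (TB-1) of LEMMA TB)

For a Weil test `G` supported in `[-a, a]`, the transform `t ↦ Ĝ(1/2 + it) = ∫ G(x) e^{itx} dx` is a
smooth function of `t` whose `n`-th derivative is the transform of `(ix)^n G` and is therefore
bounded by `a^n ‖G‖₁` (`iteratedDeriv_weilMellin_line`, `norm_iteratedDeriv_weilMellin_line_le`).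
Consequently its real and imaginary parts can be SAMPLED at any `N ≥ 1` nodes `x₁ < … < x_N` in a
window `[A, B]`: by the remainder term of polynomial interpolation
(`Literature.Analysis.Approximation.exists_interpolation_remainder`) the Lagrange interpolant `p`
of `Re Ĝ(1/2 + i·)` at the nodes satisfies, for every `t ∈ [A, B]`,

  `|Re Ĝ(1/2 + it) - p(t)| ≤ a^N ‖G‖₁ / N! · |∏ (t - xᵢ)|`

(`abs_re_weilMellin_line_sub_interpolate_le`; same for `Im`), with `‖G‖₁ ≤ (2a)^{1/2} ‖G‖₂`
(`weilNorm1_sq_le`).  This is step (TB-1) of LEMMA TB of the zero-side chain (HOME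
handoff/IDEAS-prolate.md §87, handoff/prove-1/ATTEMPT-16.md §5): the values of `Ĝ` at verified zeta
ordinates control `Ĝ` on the band they fill, with a remainder governed by `a^N/N!` times the node
polynomial.  (IDEAS-prolate uses the sharper Cauchy–Schwarz constant `a^N (2a/(2N+1))^{1/2} ‖G‖₂`;
the `L¹` form here loses only the factor `(2N+1)^{-1/2}`.)  Nothing in this file bears on the truth
of RH; no hypothesis on the zeros of `ζ` is used.
-/

set_option linter.dupNamespace false

open scoped Real Nat
open Complex MeasureTheory Set Filter Polynomial Literature.NumberTheory.LFunctions
  Literature.Analysis.Approximation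

namespace Summit.RiemannHypothesis.RiemannHypothesis.Theorems

variable {G : ℝ → ℂ} {a : ℝ}

/-- The multiplier `(ix)^n G(x)`. -/
theorem isWeilTest_mul_I_pow (hG : IsWeilTest G) (n : ℕ) :
    IsWeilTest fun x : ℝ ↦ (I * x) ^ n * G x :=
  ⟨((contDiff_const.mul Complex.ofRealCLM.contDiff).pow n).mul hG.1, hG.2.mul_left⟩

/-- `‖(ix)^n G‖₁ ≤ a^n ‖G‖₁` when `tsupport G ⊆ [-a, a]`. -/
theorem weilNorm1_mul_I_pow_le (hG : IsWeilTest G) (hsupp : tsupport G ⊆ Icc (-a) a) (n : ℕ) : weilNorm1 (fun x : ℝ ↦ (I * x) ^ n * G x) ≤ a ^ n * weilNorm1 G := by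
  unfold weilNorm1
  rw [← integral_const_mul]
  refine integral_mono_of_nonneg (Eventually.of_forall fun _ ↦ norm_nonneg _)
    (((hG.1.continuous.norm).integrable_of_hasCompactSupport hG.2.norm).const_mul _)
    (Eventually.of_forall fun x ↦ ?_)
  dsimp only
  by_cases hx : G x = 0
  · simp [hx]
  · have hxa : |x| ≤ a := abs_le.2 (by simpa using hsupp (subset_tsupport _ hx))
    rw [norm_mul, norm_pow, norm_mul, Complex.norm_I, one_mul, Complex.norm_real, Real.norm_eq_abs]
    exact mul_le_mul_of_nonneg_right (pow_le_pow_left₀ (abs_nonneg x) hxa n) (norm_nonneg _)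

/-- **Derivatives along the critical line.** `(d/dt)^n Ĝ(1/2 + it) = ((ix)^n G)^(1/2 + it)`. -/
theorem iteratedDeriv_weilMellin_line (hG : IsWeilTest G) (n : ℕ) :
    iteratedDeriv n (fun t : ℝ ↦ weilMellin G (1 / 2 + t * I)) =
      fun t : ℝ ↦ weilMellin (fun x : ℝ ↦ (I * x) ^ n * G x) (1 / 2 + t * I) := by
  induction n generalizing G with
  | zero => simp
  | succ n ih =>
    rw [iteratedDeriv_succ']
    have hd : deriv (fun t : ℝ ↦ weilMellin G (1 / 2 + t * I)) =
        fun t : ℝ ↦ weilMellin (fun x : ℝ ↦ (I * x) ^ 1 * G x) (1 / 2 + t * I) := by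
      funext t
      rw [(hasDerivAt_weilMellin_line hG t).deriv]
      simp only [pow_one]
    rw [hd, ih (isWeilTest_mul_I_pow hG 1)]
    funext t
    congr 1
    funext x
    ring

/-- `t ↦ Ĝ(1/2 + it)` is smooth. -/
theorem contDiff_weilMellin_line (hG : IsWeilTest G) (n : ℕ∞) :
    ContDiff ℝ n fun t : ℝ ↦ weilMellin G (1 / 2 + t * I) := by
  refine contDiff_of_differentiable_iteratedDeriv fun m _ ↦ ?_
  rw [iteratedDeriv_weilMellin_line hG m]
  exact fun t ↦ (hasDerivAt_weilMellin_line (isWeilTest_mul_I_pow hG m) t).differentiableAt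

/-- **Derivative bound.** `‖(d/dt)^n Ĝ(1/2 + it)‖ ≤ a^n ‖G‖₁` when `tsupport G ⊆ [-a, a]`. -/
theorem norm_iteratedDeriv_weilMellin_line_le (hG : IsWeilTest G)
    (hsupp : tsupport G ⊆ Icc (-a) a) (n : ℕ) (t : ℝ) :
    ‖iteratedDeriv n (fun t : ℝ ↦ weilMellin G (1 / 2 + t * I)) t‖ ≤ a ^ n * weilNorm1 G := by
  rw [iteratedDeriv_weilMellin_line hG n]
  exact (norm_weilMellin_half_line_le (isWeilTest_mul_I_pow hG n) t).trans
    (weilNorm1_mul_I_pow_le hG hsupp n)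

/-! ### Real and imaginary parts -/

/-- Iterated derivatives commute with taking the real part. -/
theorem iteratedDeriv_re {f : ℝ → ℂ} {n : ℕ} (hf : ContDiff ℝ n f) (t : ℝ) :
    iteratedDeriv n (fun t ↦ (f t).re) t = (iteratedDeriv n f t).re := by
  have h := Complex.reCLM.iteratedFDeriv_comp_left (hf.contDiffAt (x := t)) (i := n) le_rfl
  rw [iteratedDeriv_eq_iteratedFDeriv, iteratedDeriv_eq_iteratedFDeriv]
  change iteratedFDeriv ℝ n (Complex.reCLM ∘ f) t (fun _ ↦ 1) = _
  rw [h]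
  rfl

/-- Iterated derivatives commute with taking the imaginary part. -/
theorem iteratedDeriv_im {f : ℝ → ℂ} {n : ℕ} (hf : ContDiff ℝ n f) (t : ℝ) :
    iteratedDeriv n (fun t ↦ (f t).im) t = (iteratedDeriv n f t).im := by
  have h := Complex.imCLM.iteratedFDeriv_comp_left (hf.contDiffAt (x := t)) (i := n) le_rfl
  rw [iteratedDeriv_eq_iteratedFDeriv, iteratedDeriv_eq_iteratedFDeriv]
  change iteratedFDeriv ℝ n (Complex.imCLM ∘ f) t (fun _ ↦ 1) = _
  rw [h]
  rfl

/-- `t ↦ Re Ĝ(1/2 + it)` is `C^n` with `|(d/dt)^n Re Ĝ(1/2 + it)| ≤ a^n ‖G‖₁`. -/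
theorem contDiff_re_weilMellin_line (hG : IsWeilTest G) (n : ℕ) :
    ContDiff ℝ n fun t : ℝ ↦ (weilMellin G (1 / 2 + t * I)).re :=
  Complex.reCLM.contDiff.comp (contDiff_weilMellin_line hG n)

/-- `t ↦ Im Ĝ(1/2 + it)` is `C^n`. -/
theorem contDiff_im_weilMellin_line (hG : IsWeilTest G) (n : ℕ) :
    ContDiff ℝ n fun t : ℝ ↦ (weilMellin G (1 / 2 + t * I)).im :=
  Complex.imCLM.contDiff.comp (contDiff_weilMellin_line hG n)

/-- `|(d/dt)^n Re Ĝ(1/2 + it)| ≤ a^n ‖G‖₁`. -/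
theorem abs_iteratedDeriv_re_weilMellin_line_le (hG : IsWeilTest G)
    (hsupp : tsupport G ⊆ Icc (-a) a) (n : ℕ) (t : ℝ) :
    |iteratedDeriv n (fun t : ℝ ↦ (weilMellin G (1 / 2 + t * I)).re) t| ≤ a ^ n * weilNorm1 G := by
  rw [iteratedDeriv_re ((contDiff_weilMellin_line hG n)) t]
  exact (Complex.abs_re_le_norm _).trans (norm_iteratedDeriv_weilMellin_line_le hG hsupp n t)

/-- `|(d/dt)^n Im Ĝ(1/2 + it)| ≤ a^n ‖G‖₁`. -/
theorem abs_iteratedDeriv_im_weilMellin_line_le (hG : IsWeilTest G)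
    (hsupp : tsupport G ⊆ Icc (-a) a) (n : ℕ) (t : ℝ) :
    |iteratedDeriv n (fun t : ℝ ↦ (weilMellin G (1 / 2 + t * I)).im) t| ≤ a ^ n * weilNorm1 G := by
  rw [iteratedDeriv_im ((contDiff_weilMellin_line hG n)) t]
  exact (Complex.abs_im_le_norm _).trans (norm_iteratedDeriv_weilMellin_line_le hG hsupp n t)

/-! ### (TB-1): Lagrange sampling with remainder -/

/-- **(TB-1), real part.** For a Weil test `G` supported in `[-a, a]`, `N ≥ 1` nodes
`s ⊆ [A, B]` (`A < B`) and the Lagrange interpolant `p` of `t ↦ Re Ĝ(1/2 + it)` at the nodes: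
`|Re Ĝ(1/2 + it) - p(t)| ≤ a^N ‖G‖₁ / N! · |∏_{x ∈ s} (t - x)|` for every `t ∈ [A, B]`. -/
theorem abs_re_weilMellin_line_sub_interpolate_le (hG : IsWeilTest G)
    (hsupp : tsupport G ⊆ Icc (-a) a) {s : Finset ℝ} {N : ℕ} (hN : s.card = N) (hN0 : 0 < N)
    {A B : ℝ} (hAB : A < B) (hs : ∀ x ∈ s, x ∈ Icc A B) {t : ℝ} (ht : t ∈ Icc A B) :
    |(weilMellin G (1 / 2 + t * I)).re -
        (Lagrange.interpolate s id fun x : ℝ ↦ (weilMellin G (1 / 2 + x * I)).re).eval t| ≤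
      a ^ N * weilNorm1 G / N ! * |∏ x ∈ s, (t - x)| := by
  set F : ℝ → ℝ := fun x ↦ (weilMellin G (1 / 2 + x * I)).re with hF
  have hinj : Set.InjOn (id : ℝ → ℝ) s := Set.injOn_id _
  have hp : (Lagrange.interpolate s id F).degree < N := by
    rw [← hN]; exact Lagrange.degree_interpolate_lt F hinj
  have hfp : ∀ x ∈ s, (Lagrange.interpolate s id F).eval x = F x := fun x hx ↦ by
    simpa using Lagrange.eval_interpolate_at_node F hinj hx
  exact abs_interpolation_error_le hN hN0 (contDiff_re_weilMellin_line hG N) hp hfp hAB hs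
    (fun x _ ↦ abs_iteratedDeriv_re_weilMellin_line_le hG hsupp N x) ht

/-- **(TB-1), imaginary part.** The same for `t ↦ Im Ĝ(1/2 + it)`. -/
theorem abs_im_weilMellin_line_sub_interpolate_le (hG : IsWeilTest G)
    (hsupp : tsupport G ⊆ Icc (-a) a) {s : Finset ℝ} {N : ℕ} (hN : s.card = N) (hN0 : 0 < N)
    {A B : ℝ} (hAB : A < B) (hs : ∀ x ∈ s, x ∈ Icc A B) {t : ℝ} (ht : t ∈ Icc A B) :
    |(weilMellin G (1 / 2 + t * I)).im -
        (Lagrange.interpolate s id fun x : ℝ ↦ (weilMellin G (1 / 2 + x * I)).im).eval t| ≤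
      a ^ N * weilNorm1 G / N ! * |∏ x ∈ s, (t - x)| := by
  set F : ℝ → ℝ := fun x ↦ (weilMellin G (1 / 2 + x * I)).im with hF
  have hinj : Set.InjOn (id : ℝ → ℝ) s := Set.injOn_id _
  have hp : (Lagrange.interpolate s id F).degree < N := by
    rw [← hN]; exact Lagrange.degree_interpolate_lt F hinj
  have hfp : ∀ x ∈ s, (Lagrange.interpolate s id F).eval x = F x := fun x hx ↦ by
    simpa using Lagrange.eval_interpolate_at_node F hinj hx
  exact abs_interpolation_error_le hN hN0 (contDiff_im_weilMellin_line hG N) hp hfp hAB hs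
    (fun x _ ↦ abs_iteratedDeriv_im_weilMellin_line_le hG hsupp N x) ht

/-- The `L²` form of the constant: `a^N ‖G‖₁ ≤ a^N (2a)^{1/2} ‖G‖₂` (`weilNorm1_sq_le`). -/
theorem pow_mul_weilNorm1_le (hG : IsWeilTest G) (ha : 0 < a) (hsupp : tsupport G ⊆ Icc (-a) a)
    (N : ℕ) : a ^ N * weilNorm1 G ≤ a ^ N * Real.sqrt (2 * a * weilNorm2Sq G) := by
  refine mul_le_mul_of_nonneg_left ?_ (pow_nonneg ha.le N)
  exact (le_abs_self _).trans (Real.abs_le_sqrt (weilNorm1_sq_le hG ha hsupp))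

/-! ### (TB-1) as printed: the sampling inequality (appended 2026-08-24, prove-1 gen10) -/

/-- Evaluation of the Lagrange interpolant as a finite sum against the cardinal polynomials. -/
theorem eval_interpolate_id (s : Finset ℝ) (r : ℝ → ℝ) (t : ℝ) :
    (Lagrange.interpolate s id r).eval t = ∑ x ∈ s, r x * (Lagrange.basis s id x).eval t := by
  rw [Lagrange.interpolate_apply, eval_finsetSum]
  refine Finset.sum_congr rfl fun x _ ↦ ?_
  rw [eval_mul, eval_C]

/-- One real component: `u(t)² ≤ 2 Λ₂(t)² Σ u(xⱼ)² + 2 R²` when `|u(t) - Σ u(xⱼ)ℓⱼ(t)| ≤ R`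
(Cauchy–Schwarz on the Lagrange sum and `(x + y)² ≤ 2x² + 2y²`). -/
theorem sq_le_of_abs_sub_interpolate_le {s : Finset ℝ} {u : ℝ → ℝ} {t R : ℝ}
    (h : |u t - (Lagrange.interpolate s id u).eval t| ≤ R) :
    u t ^ 2 ≤ 2 * (∑ x ∈ s, (Lagrange.basis s id x).eval t ^ 2) * (∑ x ∈ s, u x ^ 2) + 2 * R ^ 2 := by
  rw [eval_interpolate_id] at h
  set p := ∑ x ∈ s, u x * (Lagrange.basis s id x).eval t with hp
  have hCS : p ^ 2 ≤ (∑ x ∈ s, u x ^ 2) * ∑ x ∈ s, (Lagrange.basis s id x).eval t ^ 2 :=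
    Finset.sum_mul_sq_le_sq_mul_sq s u fun x ↦ (Lagrange.basis s id x).eval t
  have hr : (u t - p) ^ 2 ≤ R ^ 2 := by
    have hR : 0 ≤ R := (abs_nonneg _).trans h
    calc (u t - p) ^ 2 = |u t - p| ^ 2 := (sq_abs _).symm
      _ ≤ R ^ 2 := pow_le_pow_left₀ (abs_nonneg _) h 2
  nlinarith [sq_nonneg (u t - 2 * p), hCS, hr]

/-- **(TB-1) (IDEAS-prolate §87.3 (1), with the `L¹` remainder constant).** For a Weil test `G`
supported in `[-a, a]`, `N ≥ 1` nodes `s ⊆ [A, B]` and `t ∈ [A, B]`: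
`|Ĝ(1/2 + it)|² ≤ 2 Λ₂(t)² Σ_{x ∈ s} |Ĝ(1/2 + ix)|² + 4 R(t)²`, where `Λ₂(t)² = Σ_{x ∈ s} ℓ_x(t)²`
(squared cardinal polynomials of the node set) and `R(t) = a^N ‖G‖₁ |∏_{x ∈ s}(t - x)| / N!`.
No property of the nodes is used beyond being real numbers in the window. -/
theorem norm_sq_weilMellin_line_le_sampling (hG : IsWeilTest G) (hsupp : tsupport G ⊆ Icc (-a) a)
    {s : Finset ℝ} {N : ℕ} (hN : s.card = N) (hN0 : 0 < N) {A B : ℝ} (hAB : A < B)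
    (hs : ∀ x ∈ s, x ∈ Icc A B) {t : ℝ} (ht : t ∈ Icc A B) :
    ‖weilMellin G (1 / 2 + t * I)‖ ^ 2 ≤
      2 * (∑ x ∈ s, (Lagrange.basis s id x).eval t ^ 2) *
          (∑ x ∈ s, ‖weilMellin G (1 / 2 + x * I)‖ ^ 2) +
        4 * (a ^ N * weilNorm1 G / N ! * |∏ x ∈ s, (t - x)|) ^ 2 := by
  have hU := sq_le_of_abs_sub_interpolate_le (u := fun x : ℝ ↦ (weilMellin G (1 / 2 + x * I)).re)
    (t := t) (abs_re_weilMellin_line_sub_interpolate_le hG hsupp hN hN0 hAB hs ht)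
  have hV := sq_le_of_abs_sub_interpolate_le (u := fun x : ℝ ↦ (weilMellin G (1 / 2 + x * I)).im)
    (t := t) (abs_im_weilMellin_line_sub_interpolate_le hG hsupp hN hN0 hAB hs ht)
  have hsq : ∀ x : ℝ, ‖weilMellin G (1 / 2 + x * I)‖ ^ 2 =
      (weilMellin G (1 / 2 + x * I)).re ^ 2 + (weilMellin G (1 / 2 + x * I)).im ^ 2 := fun x ↦ by
    rw [Complex.sq_norm, Complex.normSq_apply]; ring
  have hsum : ∑ x ∈ s, ‖weilMellin G (1 / 2 + x * I)‖ ^ 2 =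
      ∑ x ∈ s, (weilMellin G (1 / 2 + x * I)).re ^ 2 + ∑ x ∈ s, (weilMellin G (1 / 2 + x * I)).im ^ 2 := by
    rw [← Finset.sum_add_distrib]; exact Finset.sum_congr rfl fun x _ ↦ hsq x
  rw [hsq t, hsum]
  have hΛ : 0 ≤ ∑ x ∈ s, (Lagrange.basis s id x).eval t ^ 2 := Finset.sum_nonneg fun _ _ ↦ sq_nonneg _
  nlinarith [hU, hV, hΛ]

/-! ### The `L²` remainder constant `aᴺ (2a/(2N+1))^{1/2} ‖G‖₂` (appended 2026-08-24, prove-1 gen11)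

IDEAS-prolate §87.3 (1) bounds the `N`-th derivative of `t ↦ Ĝ(1/2 + it)` by Cauchy–Schwarz on the
window, `|∫ (ix)ᴺ G(x) e^{itx} dx| ≤ (∫_{-a}^{a} x^{2N})^{1/2} ‖G‖₂ = aᴺ (2a/(2N+1))^{1/2} ‖G‖₂`,
instead of the `L¹` bound `aᴺ ‖G‖₁` above; the LEMMA-TB certificates of record
(HOME handoff/prove-1/a16/cert/main.py, constant `Cn`) use this sharper constant, so the sampling
inequality is restated with it (`norm_sq_weilMellin_line_le_sampling_L2`). -/

/-- `∫_{-a}^{a} x^{2n} dx = 2 a^{2n+1}/(2n+1)` as an integral of the window indicator over the line. -/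
theorem integral_indicator_pow_two_mul (ha : 0 ≤ a) (n : ℕ) :
    ∫ x : ℝ, (Icc (-a) a).indicator (fun x : ℝ ↦ |x| ^ n) x ^ 2 = 2 * a ^ (2 * n + 1) / (2 * n + 1) := by
  have h : (fun x : ℝ ↦ (Icc (-a) a).indicator (fun x : ℝ ↦ |x| ^ n) x ^ 2) =
      (Icc (-a) a).indicator (fun x : ℝ ↦ x ^ (2 * n)) := by
    funext x
    by_cases hx : x ∈ Icc (-a) a
    · rw [indicator_of_mem hx, indicator_of_mem hx, ← pow_mul, mul_comm, pow_mul, sq_abs, ← pow_mul]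
    · rw [indicator_of_notMem hx, indicator_of_notMem hx]; simp
  rw [h, integral_indicator measurableSet_Icc, integral_Icc_eq_integral_Ioc,
    ← intervalIntegral.integral_of_le (by linarith), integral_pow]
  have hodd : (-a) ^ (2 * n + 1) = -a ^ (2 * n + 1) := by
    rw [neg_pow, pow_succ (-1 : ℝ), pow_mul]; simp
  rw [hodd]
  push_cast
  ring

/-- **Cauchy–Schwarz moment bound:** `‖((ix)ⁿ G)^(1/2 + it)‖ ≤ aⁿ (2a/(2n+1))^{1/2} ‖G‖₂` for a Weil
test `G` supported in `[-a, a]`, `a ≥ 0`. -/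
theorem norm_weilMellin_mul_I_pow_half_line_le_L2 (hG : IsWeilTest G) (ha : 0 ≤ a)
    (hsupp : tsupport G ⊆ Icc (-a) a) (n : ℕ) (t : ℝ) :
    ‖weilMellin (fun x : ℝ ↦ (I * x) ^ n * G x) (1 / 2 + t * I)‖ ≤
      Real.sqrt (2 * a ^ (2 * n + 1) / (2 * n + 1)) * Real.sqrt (weilNorm2Sq G) := by
  rw [show (1 / 2 + t * I : ℂ) = t * I + 1 / 2 by ring, weilMellin_add_half]
  set U : ℝ → ℝ := fun x ↦ (Icc (-a) a).indicator (fun x : ℝ ↦ |x| ^ n) x with hU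
  set W : ℝ → ℝ := fun x ↦ ‖G x‖ with hW
  -- pointwise: the integrand has norm `U · W`
  have hpt : ∀ x : ℝ, ‖(I * x) ^ n * G x * cexp (t * I * x)‖ = U x * W x := by
    intro x
    rw [norm_mul, norm_mul, norm_pow, norm_mul, Complex.norm_I, one_mul, Complex.norm_real,
      Real.norm_eq_abs, show (t : ℂ) * I * (x : ℂ) = ((t * x : ℝ) : ℂ) * I by push_cast; ring,
      Complex.norm_exp_ofReal_mul_I, mul_one]
    by_cases hx : x ∈ Icc (-a) a
    · simp only [hU, hW, indicator_of_mem hx]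
    · simp only [hU, hW, indicator_of_notMem hx, eq_zero_of_tsupport_subset hsupp hx, norm_zero,
        mul_zero]
  have h1 : ‖∫ x : ℝ, (I * x) ^ n * G x * cexp (t * I * x)‖ ≤ ∫ x : ℝ, U x * W x := by
    refine (norm_integral_le_integral_norm _).trans (le_of_eq ?_)
    exact integral_congr_ae (Eventually.of_forall hpt)
  -- Hölder with `p = q = 2`
  have hU0 : 0 ≤ᵐ[volume] U := Eventually.of_forall fun x ↦
    Set.indicator_nonneg (fun y _ ↦ by positivity) x
  have hW0 : 0 ≤ᵐ[volume] W := Eventually.of_forall fun _ ↦ norm_nonneg _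
  have hUc : MemLp U 2 := by
    rw [hU, memLp_indicator_iff_restrict measurableSet_Icc,
      memLp_two_iff_integrable_sq_norm (by fun_prop : Continuous fun x : ℝ ↦ |x| ^ n).aestronglyMeasurable]
    exact (by fun_prop : Continuous fun x : ℝ ↦ ‖|x| ^ n‖ ^ 2).integrableOn_Icc
  have hWc : MemLp W 2 := hG.1.continuous.norm.memLp_of_hasCompactSupport hG.2.norm
  have hUm : MemLp U (ENNReal.ofReal 2) volume := by rwa [show ENNReal.ofReal 2 = 2 by norm_num]
  have hWm : MemLp W (ENNReal.ofReal 2) volume := by rwa [show ENNReal.ofReal 2 = 2 by norm_num]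
  have hH := integral_mul_le_Lp_mul_Lq_of_nonneg Real.HolderConjugate.two_two hU0 hW0 hUm hWm
  have eU : ∫ x : ℝ, U x ^ (2 : ℝ) = 2 * a ^ (2 * n + 1) / (2 * n + 1) := by
    rw [← integral_indicator_pow_two_mul ha n]
    exact integral_congr_ae (Eventually.of_forall fun x ↦ by simp [hU])
  have eW : ∫ x : ℝ, W x ^ (2 : ℝ) = weilNorm2Sq G := by
    unfold weilNorm2Sq
    exact integral_congr_ae (Eventually.of_forall fun x ↦ by simp [hW])
  rw [eU, eW] at hH
  have hs : ∀ y : ℝ, y ^ (1 / (2 : ℝ)) = Real.sqrt y := fun y ↦ by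
    rw [Real.sqrt_eq_rpow]
  rw [hs, hs] at hH
  exact h1.trans hH

/-- **Derivative bound, `L²` form:** `‖(d/dt)ⁿ Ĝ(1/2 + it)‖ ≤ (2a^{2n+1}/(2n+1))^{1/2} ‖G‖₂`. -/
theorem norm_iteratedDeriv_weilMellin_line_le_L2 (hG : IsWeilTest G) (ha : 0 ≤ a)
    (hsupp : tsupport G ⊆ Icc (-a) a) (n : ℕ) (t : ℝ) :
    ‖iteratedDeriv n (fun t : ℝ ↦ weilMellin G (1 / 2 + t * I)) t‖ ≤
      Real.sqrt (2 * a ^ (2 * n + 1) / (2 * n + 1)) * Real.sqrt (weilNorm2Sq G) := by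
  rw [iteratedDeriv_weilMellin_line hG n]
  exact norm_weilMellin_mul_I_pow_half_line_le_L2 hG ha hsupp n t

/-- **(TB-1), real part, `L²` remainder.** -/
theorem abs_re_weilMellin_line_sub_interpolate_le_L2 (hG : IsWeilTest G) (ha : 0 ≤ a)
    (hsupp : tsupport G ⊆ Icc (-a) a) {s : Finset ℝ} {N : ℕ} (hN : s.card = N) (hN0 : 0 < N)
    {A B : ℝ} (hAB : A < B) (hs : ∀ x ∈ s, x ∈ Icc A B) {t : ℝ} (ht : t ∈ Icc A B) :
    |(weilMellin G (1 / 2 + t * I)).re -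
        (Lagrange.interpolate s id fun x : ℝ ↦ (weilMellin G (1 / 2 + x * I)).re).eval t| ≤
      Real.sqrt (2 * a ^ (2 * N + 1) / (2 * N + 1)) * Real.sqrt (weilNorm2Sq G) / N ! *
        |∏ x ∈ s, (t - x)| := by
  set F : ℝ → ℝ := fun x ↦ (weilMellin G (1 / 2 + x * I)).re with hF
  have hinj : Set.InjOn (id : ℝ → ℝ) s := Set.injOn_id _
  have hp : (Lagrange.interpolate s id F).degree < N := by
    rw [← hN]; exact Lagrange.degree_interpolate_lt F hinj
  have hfp : ∀ x ∈ s, (Lagrange.interpolate s id F).eval x = F x := fun x hx ↦ by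
    simpa using Lagrange.eval_interpolate_at_node F hinj hx
  refine abs_interpolation_error_le hN hN0 (contDiff_re_weilMellin_line hG N) hp hfp hAB hs
    (fun x _ ↦ ?_) ht
  rw [iteratedDeriv_re ((contDiff_weilMellin_line hG N)) x]
  exact (Complex.abs_re_le_norm _).trans (norm_iteratedDeriv_weilMellin_line_le_L2 hG ha hsupp N x)

/-- **(TB-1), imaginary part, `L²` remainder.** -/
theorem abs_im_weilMellin_line_sub_interpolate_le_L2 (hG : IsWeilTest G) (ha : 0 ≤ a)
    (hsupp : tsupport G ⊆ Icc (-a) a) {s : Finset ℝ} {N : ℕ} (hN : s.card = N) (hN0 : 0 < N)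
    {A B : ℝ} (hAB : A < B) (hs : ∀ x ∈ s, x ∈ Icc A B) {t : ℝ} (ht : t ∈ Icc A B) :
    |(weilMellin G (1 / 2 + t * I)).im -
        (Lagrange.interpolate s id fun x : ℝ ↦ (weilMellin G (1 / 2 + x * I)).im).eval t| ≤
      Real.sqrt (2 * a ^ (2 * N + 1) / (2 * N + 1)) * Real.sqrt (weilNorm2Sq G) / N ! *
        |∏ x ∈ s, (t - x)| := by
  set F : ℝ → ℝ := fun x ↦ (weilMellin G (1 / 2 + x * I)).im with hF
  have hinj : Set.InjOn (id : ℝ → ℝ) s := Set.injOn_id _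
  have hp : (Lagrange.interpolate s id F).degree < N := by
    rw [← hN]; exact Lagrange.degree_interpolate_lt F hinj
  have hfp : ∀ x ∈ s, (Lagrange.interpolate s id F).eval x = F x := fun x hx ↦ by
    simpa using Lagrange.eval_interpolate_at_node F hinj hx
  refine abs_interpolation_error_le hN hN0 (contDiff_im_weilMellin_line hG N) hp hfp hAB hs
    (fun x _ ↦ ?_) ht
  rw [iteratedDeriv_im ((contDiff_weilMellin_line hG N)) x]
  exact (Complex.abs_im_le_norm _).trans (norm_iteratedDeriv_weilMellin_line_le_L2 hG ha hsupp N x)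

/-- **(TB-1) with the `L²` remainder constant of IDEAS-prolate §87.3 (1) and of the certificates of
record.** For a Weil test `G` supported in `[-a, a]` (`a ≥ 0`), `N ≥ 1` nodes `s ⊆ [A, B]` and
`t ∈ [A, B]`:
`|Ĝ(1/2 + it)|² ≤ 2 Λ₂(t)² Σ_{x ∈ s} |Ĝ(1/2 + ix)|² + 4 · (2a^{2N+1}/(2N+1)) ‖G‖₂² ω(t)²/(N!)²`,
`ω(t) = ∏_{x ∈ s}(t - x)`. -/
theorem norm_sq_weilMellin_line_le_sampling_L2 (hG : IsWeilTest G) (ha : 0 ≤ a)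
    (hsupp : tsupport G ⊆ Icc (-a) a) {s : Finset ℝ} {N : ℕ} (hN : s.card = N) (hN0 : 0 < N)
    {A B : ℝ} (hAB : A < B) (hs : ∀ x ∈ s, x ∈ Icc A B) {t : ℝ} (ht : t ∈ Icc A B) :
    ‖weilMellin G (1 / 2 + t * I)‖ ^ 2 ≤
      2 * (∑ x ∈ s, (Lagrange.basis s id x).eval t ^ 2) *
          (∑ x ∈ s, ‖weilMellin G (1 / 2 + x * I)‖ ^ 2) +
        4 * (2 * a ^ (2 * N + 1) / (2 * N + 1) * weilNorm2Sq G / (N ! : ℝ) ^ 2 *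
          (∏ x ∈ s, (t - x)) ^ 2) := by
  have hU := sq_le_of_abs_sub_interpolate_le (u := fun x : ℝ ↦ (weilMellin G (1 / 2 + x * I)).re)
    (t := t) (abs_re_weilMellin_line_sub_interpolate_le_L2 hG ha hsupp hN hN0 hAB hs ht)
  have hV := sq_le_of_abs_sub_interpolate_le (u := fun x : ℝ ↦ (weilMellin G (1 / 2 + x * I)).im)
    (t := t) (abs_im_weilMellin_line_sub_interpolate_le_L2 hG ha hsupp hN hN0 hAB hs ht)
  have hsq : ∀ x : ℝ, ‖weilMellin G (1 / 2 + x * I)‖ ^ 2 =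
      (weilMellin G (1 / 2 + x * I)).re ^ 2 + (weilMellin G (1 / 2 + x * I)).im ^ 2 := fun x ↦ by
    rw [Complex.sq_norm, Complex.normSq_apply]; ring
  have hsum : ∑ x ∈ s, ‖weilMellin G (1 / 2 + x * I)‖ ^ 2 =
      ∑ x ∈ s, (weilMellin G (1 / 2 + x * I)).re ^ 2 + ∑ x ∈ s, (weilMellin G (1 / 2 + x * I)).im ^ 2 := by
    rw [← Finset.sum_add_distrib]; exact Finset.sum_congr rfl fun x _ ↦ hsq x
  -- the squared remainder constant
  have hR : (Real.sqrt (2 * a ^ (2 * N + 1) / (2 * N + 1)) * Real.sqrt (weilNorm2Sq G) / N ! *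
      |∏ x ∈ s, (t - x)|) ^ 2 =
      2 * a ^ (2 * N + 1) / (2 * N + 1) * weilNorm2Sq G / (N ! : ℝ) ^ 2 * (∏ x ∈ s, (t - x)) ^ 2 := by
    have h1 : 0 ≤ 2 * a ^ (2 * N + 1) / (2 * N + 1) := by positivity
    have h2 : 0 ≤ weilNorm2Sq G := integral_nonneg fun _ ↦ sq_nonneg _
    rw [mul_pow, div_pow, mul_pow, Real.sq_sqrt h1, Real.sq_sqrt h2, sq_abs]
  rw [hsq t, hsum, ← hR]
  have hΛ : 0 ≤ ∑ x ∈ s, (Lagrange.basis s id x).eval t ^ 2 := Finset.sum_nonneg fun _ _ ↦ sq_nonneg _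
  nlinarith [hU, hV, hΛ]

end Summit.RiemannHypothesis.RiemannHypothesis.Theorems
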